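import Summits.CriticalPhenomena.PercolationContinuityZ3.Theorems.PercNearOneGluingNoHeavyLowerTailSahiCombTriWCommonBottom
import Summits.CriticalPhenomena.PercolationContinuityZ3.Theorems.PercNearOneGluingNoHeavyLowerTailSahiCombTriWAntiNestedKernelProof

/-!
# The HALF-CHAIN stratum of `TRI_W(2)`: the exact netted token identity and the typed Hall target `HalfChainHall` (machine-proved in rank form)

Support file of the one-cut programme (crux `NoHeavyLowerTail`, stmt-CriticalPhenomena-4575; cell `prim-masterthm`, seat P5 gen 28;
memo `FROM-prim-masterthm-p5-g28-HALFCHAIN-CERTIFICATES.md` §1, §5d–§5f).  Target `FiveUpSet.TriWIneq` (`…SahiCombTriWGeneral`, OPEN for `a ≥ 2`);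
half-chain sub-target `FiveUpSet.HalfChainMidIneq` (`…TriWHalfChainMid`, P5 gen 27): at `a = 2` with `G{a} ⊆ G{b}` and `F` an ARBITRARY diamond.

* **`FiveUpSet.inner_pair_eq_halfChain`** — the EXACT identity on the half-chain stratum `Gp ⊆ Gq` (all reflected terms netted into two shell demands):
  `triWOne(P;F₀,F₁;G₀,G₁) + triWOne(P;Fp,Fq;Gp,Gq) = halfChainSupply − halfChainDemand`,
  `halfChainSupply = 2·#(P∩F₁∩G₁) + 2·#(P∩F₀∩G₀) + 2·#(P∩Fp∩Gp) + 2·#(P∩Fq∩Gq)` (four up-set supply levels, two copies each),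
  `halfChainDemand = #(P∩rF₀∩G₁) + #(P∩F₀∩rG₁) + #(P∩rF₁∩G₀) + #(P∩F₁∩rG₀) + #(P∩rFp∩Gq) + #(P∩Fp∩rGq) + #(P∩rFq∩Gp) + #(P∩Fq∩rGp)
  + #(P∩r((Fq\Fp)∩(Gq\Gp))) + #(P∩rΣ)`, `Σ = ((F₁\F₀)∩(G₁\G₀)) \ ((Fp\Fq)∩(Gq\Gp))` (`r` = `refl`).
* **`FiveUpSet.HalfChainHall`** (`@[conjecture]`, OURS — an obligation of the theory, never a fact) — `halfChainDemand ≤ halfChainSupply` inside every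
  up-set `P`, for up-sets `F₀ ⊆ Fp, Fq ⊆ F₁`, `G₀ ⊆ Gp ⊆ Gq ⊆ G₁`.  By the identity it is EQUIVALENT to `HalfChainMidIneq` / to `TriWIneq` on the half-chain
  stratum.  EVIDENCE (P5 gen 28): its RANK form (zeta rows of the ten demand classes against the eight supply levels, 0/1 visibility designs extending
  proved designs of the sub-system `G₀ = ∅`) is full row rank on 3,000 random configurations (`n ≤ 6`) for hundreds of designs, and **the sound coarse prover
  `cprove2` of P5 gen 16 (rules = lemmas of `…FiveUpSetRank`; it produced the AN♯1/AN♯3 proofs now in the tree) PROVES ≥ 24 of them** (e.g. the design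
  `rF₀G₁→{S_a}, F₀rG₁→{S_b,N_a}, rF₁G₀→{S_b,U_b,M_a,N_b}, F₁rG₀→{S_a,U_a}, rFpGq→{S_b,M_b}, FprGq→{S_a,S_b,N_b}, rFqGp→{S_a,M_a,N_a}, FqrGp→{S_a,S_b},
  r((Fq\Fp)(Gq\Gp))→{N_b}, rΣ→{S_a}` with `S,U,M,N` = the two copies of `F₁G₁, F₀G₀, FpGp, FqGq`; kill order `rFq∩Gp, rF₁∩G₀, Fq∩rGp, shell, F₀∩rG₁, rF₀∩G₁, F₁∩rG₀,
  rFp∩Gq, Fp∩rGq, rΣ`; 486-line log; encoding sanity: numerically invalid designs are never proved).  No POINTWISE five-up-set certificate exists for this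
  stratum (exact LP value `1/7` already on `G ∅ = G{a} = ∅`).  Lean formalisation of the kernel proof = next seat (pattern `…AntiNestedKernelProof`).
* **`FiveUpSet.inner_pair_le_of_halfChainHall`**, **`FiveUpSet.triW_nonneg_of_halfChain_of_hall`** — the reduction `HalfChainHall ⟹ 0 ≤ triW` on `G{a} ⊆ G{b}`.
HONEST LABEL: an exact identity, a typed conjecture (machine-proved outside Lean, census-clean) and its reduction; no new unconditional stratum in this file. [this work]
-/

namespace Summit.CriticalPhenomena.PercolationContinuityZ3.Theorems

namespace FiveUpSet

open Finset LatticeFiveUpSet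

variable {γ : Type} [DecidableEq γ] [Fintype γ]

/-- HALF-CHAIN supply count inside `P`: the four up-set levels `F₁∩G₁, F₀∩G₀, Fp∩Gp, Fq∩Gq`, two copies each. [this work] -/
def halfChainSupply (P F₀ Fp Fq F₁ G₀ Gp Gq G₁ : Finset (Finset γ)) : ℕ :=
  2 * (P ∩ F₁ ∩ G₁).card + 2 * (P ∩ F₀ ∩ G₀).card + 2 * (P ∩ Fp ∩ Gp).card + 2 * (P ∩ Fq ∩ Gq).card

/-- HALF-CHAIN demand count inside `P` (ten classes; `Σ = ((F₁\F₀)∩(G₁\G₀)) \ ((Fp\Fq)∩(Gq\Gp))`). [this work] -/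
def halfChainDemand (P F₀ Fp Fq F₁ G₀ Gp Gq G₁ : Finset (Finset γ)) : ℕ :=
  (P ∩ refl F₀ ∩ G₁).card + (P ∩ F₀ ∩ refl G₁).card + (P ∩ refl F₁ ∩ G₀).card + (P ∩ F₁ ∩ refl G₀).card
    + (P ∩ refl Fp ∩ Gq).card + (P ∩ Fp ∩ refl Gq).card + (P ∩ refl Fq ∩ Gp).card + (P ∩ Fq ∩ refl Gp).card
    + (P ∩ refl ((Fq \ Fp) ∩ (Gq \ Gp))).card + (P ∩ refl (((F₁ \ F₀) ∩ (G₁ \ G₀)) \ ((Fp \ Fq) ∩ (Gq \ Gp)))).card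

/-- **HALF-CHAIN HALL** (CONJECTURE — an obligation of our theory, never a fact; machine-proved in rank form by `cprove2`, P5 gen 28): for up-sets
`P`, `F₀ ⊆ Fp, Fq ⊆ F₁`, `G₀ ⊆ Gp ⊆ Gq ⊆ G₁` of a finite cube, `halfChainDemand ≤ halfChainSupply`.  Equivalent to `HalfChainMidIneq`. [this work] -/
@[conjecture] def HalfChainHall : Prop :=
  ∀ (γ : Type) [DecidableEq γ] [Fintype γ] (P F₀ Fp Fq F₁ G₀ Gp Gq G₁ : Finset (Finset γ)),
    IsUpperSet (P : Set (Finset γ)) → IsUpperSet (F₀ : Set (Finset γ)) → IsUpperSet (Fp : Set (Finset γ)) → IsUpperSet (Fq : Set (Finset γ)) →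
    IsUpperSet (F₁ : Set (Finset γ)) → IsUpperSet (G₀ : Set (Finset γ)) → IsUpperSet (Gp : Set (Finset γ)) → IsUpperSet (Gq : Set (Finset γ)) →
    IsUpperSet (G₁ : Set (Finset γ)) →
    F₀ ⊆ Fp → F₀ ⊆ Fq → Fp ⊆ F₁ → Fq ⊆ F₁ → G₀ ⊆ Gp → Gp ⊆ Gq → Gq ⊆ G₁ →
    halfChainDemand P F₀ Fp Fq F₁ G₀ Gp Gq G₁ ≤ halfChainSupply P F₀ Fp Fq F₁ G₀ Gp Gq G₁

set_option synthInstance.maxHeartbeats 400000 in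
set_option synthInstance.maxSize 4096 in
set_option maxHeartbeats 1600000 in
/-- **The exact token identity on the half-chain stratum** (bookkeeping hypotheses: the diamond/chain inclusions; `Gp ⊆ Gq` is what makes the netting valid):
`triWOne(P;F₀,F₁;G₀,G₁) + triWOne(P;Fp,Fq;Gp,Gq) = halfChainSupply − halfChainDemand`. [this work] -/
theorem inner_pair_eq_halfChain (P F₀ Fp Fq F₁ G₀ Gp Gq G₁ : Finset (Finset γ))
    (hF0p : F₀ ⊆ Fp) (hF0q : F₀ ⊆ Fq) (hFp1 : Fp ⊆ F₁) (hFq1 : Fq ⊆ F₁) (hG0p : G₀ ⊆ Gp) (hG0q : G₀ ⊆ Gq) (hGp1 : Gp ⊆ G₁) (hGq1 : Gq ⊆ G₁)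
    (hGpq : Gp ⊆ Gq) :
    triWOne (complEquiv γ) P F₀ F₁ G₀ G₁ + triWOne (complEquiv γ) P Fp Fq Gp Gq
      = (halfChainSupply P F₀ Fp Fq F₁ G₀ Gp Gq G₁ : ℤ) - (halfChainDemand P F₀ Fp Fq F₁ G₀ Gp Gq G₁ : ℤ) := by
  rw [triWOne_expand, triWOne_expand]
  unfold halfChainSupply halfChainDemand
  push_cast
  have h1 : 0 ≤ 1 * ((2 * (((P ∩ F₀ ∩ G₀).card : ℤ) + ((P ∩ F₁ ∩ G₁).card : ℤ)) - (((P ∩ refl F₀ ∩ G₁).card : ℤ) + ((P ∩ refl F₁ ∩ G₀).card : ℤ)) - (((P ∩ F₀ ∩ refl G₁).card : ℤ) + ((P ∩ F₁ ∩ refl G₀).card : ℤ)) - (((P ∩ refl F₀ ∩ refl G₀).card : ℤ) + ((P ∩ refl F₁ ∩ refl G₁).card : ℤ)) + (((P ∩ refl F₀ ∩ refl G₁).card : ℤ) + ((P ∩ refl F₁ ∩ refl G₀).card : ℤ))) + (2 * (((P ∩ Fp ∩ Gp).card : ℤ) + ((P ∩ Fq ∩ Gq).card : ℤ)) - (((P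 ∩ refl Fp ∩ Gq).card : ℤ) + ((P ∩ refl Fq ∩ Gp).card : ℤ)) - (((P ∩ Fp ∩ refl Gq).card : ℤ) + ((P ∩ Fq ∩ refl Gp).card : ℤ)) - (((P ∩ refl Fp ∩ refl Gp).card : ℤ) + ((P ∩ refl Fq ∩ refl Gq).card : ℤ)) + (((P ∩ refl Fp ∩ refl Gq).card : ℤ) + ((P ∩ refl Fq ∩ refl Gp).card : ℤ)))) - (1 * (2 * ((P ∩ F₁ ∩ G₁).card : ℤ) + 2 * ((P ∩ F₀ ∩ G₀).card : ℤ) + 2 * ((P ∩ Fp ∩ Gp).card : ℤ) + 2 * ((P ∩ Fq ∩ Gq).card : ℤ)) - 1 * (((P ∩ refl F₀ ∩ G₁).card : ℤ) + ((P ∩ F₀ ∩ refl G₁).card : ℤ) + ((P ∩ refl F₁ ∩ G₀).card : ℤ) + ((P ∩ F₁ ∩ refl G₀).card : ℤ) + ((P ∩ refl Fp ∩ Gq).card : ℤ) + ((P ∩ Fp ∩ refl Gq).card : ℤ) + ((P ∩ refl Fq ∩ Gp).card : ℤ) + ((P ∩ Fq ∩ refl Gp).card : ℤ) + ((P ∩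 refl ((Fq \ Fp) ∩ (Gq \ Gp))).card : ℤ) + ((P ∩ refl (((F₁ \ F₀) ∩ (G₁ \ G₀)) \ ((Fp \ Fq) ∩ (Gq \ Gp)))).card : ℤ))) := by
    simp only [card_eq_univ_sum]
    simp only [mem_inter, mem_refl, mem_sdiff]
    simp only [mul_add, mul_sub]
    simp only [Finset.mul_sum, ← Finset.sum_add_distrib, ← Finset.sum_sub_distrib]
    refine Finset.sum_nonneg (fun w _ => ?_)
    obtain ⟨s₁, a0, ap, aq, a1⟩ := diamond_pos hF0p hF0q hFp1 hFq1 w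
    obtain ⟨s₂, b0, bp, bq, b1⟩ := diamond_pos hG0p hG0q hGp1 hGq1 w
    obtain ⟨s₃, c0, cp, cq, c1⟩ := diamond_pos hF0p hF0q hFp1 hFq1 wᶜ
    obtain ⟨s₄, d0, dp, dq, d1⟩ := diamond_pos hG0p hG0q hGp1 hGq1 wᶜ
    have gpq : (s₂ = 2 ∨ s₂ = 4 ∨ s₂ = 5) → (s₂ = 3 ∨ s₂ = 4 ∨ s₂ = 5) := fun h => bq.mp (hGpq (bp.mpr h))
    have gpq' : (s₄ = 2 ∨ s₄ = 4 ∨ s₄ = 5) → (s₄ = 3 ∨ s₄ = 4 ∨ s₄ = 5) := fun h => dq.mp (hGpq (dp.mpr h))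
    simp only [a0, ap, aq, a1, b0, bp, bq, b1, c0, cp, cq, c1, d0, dp, dq, d1]
    clear a0 ap aq a1 b0 bp bq b1 c0 cp cq c1 d0 dp dq d1
    by_cases hp : w ∈ P <;> simp only [hp] <;> (revert s₁ s₂ s₃ s₄; decide)
  have h2 : 0 ≤ (1 * (2 * ((P ∩ F₁ ∩ G₁).card : ℤ) + 2 * ((P ∩ F₀ ∩ G₀).card : ℤ) + 2 * ((P ∩ Fp ∩ Gp).card : ℤ) + 2 * ((P ∩ Fq ∩ Gq).card : ℤ)) - 1 * (((P ∩ refl F₀ ∩ G₁).card : ℤ) + ((P ∩ F₀ ∩ refl G₁).card : ℤ) + ((P ∩ refl F₁ ∩ G₀).card : ℤ) + ((P ∩ F₁ ∩ refl G₀).card : ℤ) + ((P ∩ refl Fp ∩ Gq).card : ℤ) + ((P ∩ Fp ∩ refl Gq).card : ℤ) + ((P ∩ refl Fq ∩ Gp).card : ℤ) + ((P ∩ Fq ∩ refl Gp).card : ℤ) + ((P ∩ refl ((Fq \ Fp) ∩ (Gq \ Gp))).card : ℤ) + ((P ∩ refl (((F₁ \ F₀) ∩ (G₁ \ G₀)) \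 ((Fp \ Fq) ∩ (Gq \ Gp)))).card : ℤ))) - 1 * ((2 * (((P ∩ F₀ ∩ G₀).card : ℤ) + ((P ∩ F₁ ∩ G₁).card : ℤ)) - (((P ∩ refl F₀ ∩ G₁).card : ℤ) + ((P ∩ refl F₁ ∩ G₀).card : ℤ)) - (((P ∩ F₀ ∩ refl G₁).card : ℤ) + ((P ∩ F₁ ∩ refl G₀).card : ℤ)) - (((P ∩ refl F₀ ∩ refl G₀).card : ℤ) + ((P ∩ refl F₁ ∩ refl G₁).card : ℤ)) + (((P ∩ refl F₀ ∩ refl G₁).card : ℤ) + ((P ∩ refl F₁ ∩ refl G₀).card : ℤ))) + (2 * (((P ∩ Fp ∩ Gp).card : ℤ) + ((P ∩ Fq ∩ Gq).card : ℤ)) - (((P ∩ refl Fp ∩ Gq).card : ℤ) + ((P ∩ refl Fq ∩ Gp).card : ℤ)) - (((P ∩ Fp ∩ refl Gq).card : ℤ) + ((P ∩ Fq ∩ refl Gp).card : ℤ)) - (((P ∩ refl Fp ∩ refl Gp).card : ℤ) + ((P ∩ refl Fq ∩ refl Gq).card : ℤ)) + (((P ∩ refl Fp ∩ refl Gq).card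 : ℤ) + ((P ∩ refl Fq ∩ refl Gp).card : ℤ)))) := by
    simp only [card_eq_univ_sum]
    simp only [mem_inter, mem_refl, mem_sdiff]
    simp only [mul_add, mul_sub]
    simp only [Finset.mul_sum, ← Finset.sum_add_distrib, ← Finset.sum_sub_distrib]
    refine Finset.sum_nonneg (fun w _ => ?_)
    obtain ⟨s₁, a0, ap, aq, a1⟩ := diamond_pos hF0p hF0q hFp1 hFq1 w
    obtain ⟨s₂, b0, bp, bq, b1⟩ := diamond_pos hG0p hG0q hGp1 hGq1 w
    obtain ⟨s₃, c0, cp, cq, c1⟩ := diamond_pos hF0p hF0q hFp1 hFq1 wᶜ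
    obtain ⟨s₄, d0, dp, dq, d1⟩ := diamond_pos hG0p hG0q hGp1 hGq1 wᶜ
    have gpq : (s₂ = 2 ∨ s₂ = 4 ∨ s₂ = 5) → (s₂ = 3 ∨ s₂ = 4 ∨ s₂ = 5) := fun h => bq.mp (hGpq (bp.mpr h))
    have gpq' : (s₄ = 2 ∨ s₄ = 4 ∨ s₄ = 5) → (s₄ = 3 ∨ s₄ = 4 ∨ s₄ = 5) := fun h => dq.mp (hGpq (dp.mpr h))
    simp only [a0, ap, aq, a1, b0, bp, bq, b1, c0, cp, cq, c1, d0, dp, dq, d1]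
    clear a0 ap aq a1 b0 bp bq b1 c0 cp cq c1 d0 dp dq d1
    by_cases hp : w ∈ P <;> simp only [hp] <;> (revert s₁ s₂ s₃ s₄; decide)
  linarith [h1, h2]

/-- **HALF-CHAIN HALL ⟹ the pair sum on the half-chain stratum is non-negative.** [this work] -/
theorem inner_pair_le_of_halfChainHall (h : HalfChainHall) (P F₀ Fp Fq F₁ G₀ Gp Gq G₁ : Finset (Finset γ)) (hP : IsUpperSet (P : Set (Finset γ)))
    (hF₀ : IsUpperSet (F₀ : Set (Finset γ))) (hFp : IsUpperSet (Fp : Set (Finset γ))) (hFq : IsUpperSet (Fq : Set (Finset γ)))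
    (hF₁ : IsUpperSet (F₁ : Set (Finset γ))) (hG₀ : IsUpperSet (G₀ : Set (Finset γ))) (hGp : IsUpperSet (Gp : Set (Finset γ)))
    (hGq : IsUpperSet (Gq : Set (Finset γ))) (hG₁ : IsUpperSet (G₁ : Set (Finset γ)))
    (hF0p : F₀ ⊆ Fp) (hF0q : F₀ ⊆ Fq) (hFp1 : Fp ⊆ F₁) (hFq1 : Fq ⊆ F₁) (hG0p : G₀ ⊆ Gp) (hGpq : Gp ⊆ Gq) (hGq1 : Gq ⊆ G₁) :
    0 ≤ triWOne (complEquiv γ) P F₀ F₁ G₀ G₁ + triWOne (complEquiv γ) P Fp Fq Gp Gq := by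
  rw [inner_pair_eq_halfChain P F₀ Fp Fq F₁ G₀ Gp Gq G₁ hF0p hF0q hFp1 hFq1 hG0p (hG0p.trans hGpq) (hGpq.trans hGq1) hGq1 hGpq]
  have := h γ P F₀ Fp Fq F₁ G₀ Gp Gq G₁ hP hF₀ hFp hFq hF₁ hG₀ hGp hGq hG₁ hF0p hF0q hFp1 hFq1 hG0p hGpq hGq1
  omega

/-- **HALF-CHAIN HALL ⟹ `TRI_W(2) ≥ 0` on the whole half-chain stratum `G{a} ⊆ G{b}`** (index cube with two atoms `a ≠ b`; `F` arbitrary). [this work] -/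
theorem triW_nonneg_of_halfChain_of_hall (h : HalfChainHall) {β : Type} [DecidableEq β] [Fintype β] {a b : β} (hab : a ≠ b)
    (hu : (univ : Finset β) = {a, b}) (P : Finset (Finset γ)) (F G : Finset β → Finset (Finset γ))
    (hP : IsUpperSet (P : Set (Finset γ))) (hF : ∀ x, IsUpperSet (F x : Set (Finset γ))) (hG : ∀ x, IsUpperSet (G x : Set (Finset γ)))
    (hFm : Monotone F) (hGm : Monotone G) (hGab : G {a} ⊆ G {b}) : 0 ≤ triW P F G := by
  refine LatticeFiveUpSet.triW_nonneg_of_pair_nonneg hab hu P F G ?_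
  exact inner_pair_le_of_halfChainHall h P (F ∅) (F {a}) (F {b}) (F univ) (G ∅) (G {a}) (G {b}) (G univ) hP (hF ∅) (hF {a}) (hF {b}) (hF univ)
    (hG ∅) (hG {a}) (hG {b}) (hG univ) (hFm (empty_subset _)) (hFm (empty_subset _)) (hFm (subset_univ _)) (hFm (subset_univ _))
    (hGm (empty_subset _)) hGab (hGm (subset_univ _))

/-! ### The mirror orientation (appended, P5 gen 29) -/

/-- **HALF-CHAIN HALL ⟹ `TRI_W(2) ≥ 0` on the mirror half-chain stratum `G{b} ⊆ G{a}`** (relabel the two atoms; appended by P5 gen 29, whose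
`…TriWHalfChainKernel` / `…TriWHalfChainHallProof` prove `HalfChainHall`). [this work] -/
theorem triW_nonneg_of_halfChain_of_hall' (h : HalfChainHall) {β : Type} [DecidableEq β] [Fintype β] {a b : β} (hab : a ≠ b)
    (hu : (univ : Finset β) = {a, b}) (P : Finset (Finset γ)) (F G : Finset β → Finset (Finset γ))
    (hP : IsUpperSet (P : Set (Finset γ))) (hF : ∀ x, IsUpperSet (F x : Set (Finset γ))) (hG : ∀ x, IsUpperSet (G x : Set (Finset γ)))
    (hFm : Monotone F) (hGm : Monotone G) (hGba : G {b} ⊆ G {a}) : 0 ≤ triW P F G := by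
  have hu' : (univ : Finset β) = {b, a} := by rw [hu, pair_comm]
  exact triW_nonneg_of_halfChain_of_hall h hab.symm hu' P F G hP hF hG hFm hGm hGba

end FiveUpSet

end Summit.CriticalPhenomena.PercolationContinuityZ3.Theorems
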